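import Summits.Ventures.Crystal3D.Theorems.StickyWulffConstantTextureBuildTentCert
import Summits.Ventures.Crystal3D.Theorems.StickyWulffConstantTextureBuildPatchRigidity
import Summits.Ventures.Crystal3D.Theorems.StickyWulffConstantTextureBuildBarlowShells
import Summits.Ventures.Crystal3D.Theorems.StickyWulffConstantTextureBuildSlabPieces
import Literature.MathematicalPhysics.StatisticalMechanics.BarlowCovering
import HarnessLib

/-!
# TB-energy blueprint, FRAME AGREEMENT: two grains whose stackings coincide near a contact carry slab frames with one lattice or one axis
# (lane T, crux `TextureLiminfV5`, stmt-Ventures-23912; TB-D-3-g20 §LP2 rows (TT≠)/(QX) «the frame-identification lemma», §LS)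

HONEST FRAMING. Venture `Summits/Ventures/Crystal3D` (cell `crystal3d-full`), route `route-Ventures-StickyWulffConstant`, helper `--supports` the
law-v5 crux `TextureLiminfV5` (stmt-Ventures-23912).  Pure lattice / slab geometry of tent pieces (census-free, standard axioms); nothing about any
cover or mesh is constructed; F-C1 not moved.

WHY.  In the contact classification (L-P2) an AGREEMENT contact (`Mesh₄.hagreeFr`, `hmatchFr`: the stackings of grains `f ≠ g` coincide on a ball
around the contact, and either their axes are parallel or one affine fcc lattice contains the common sites) must be FREE for the texture's law data:
the canonical frames `Tf.frame a`, `Tg.frame b` of the two slab classes meeting there must have equal lattices (`lawC = 0`) or share the axis normal to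
the contact plane (`h_{D(m)}(±m) = 0`).  This file proves exactly that, from the radius-`1` patch rigidity (…TextureBuildPatchRigidity) and the
covering radius of a bilayer (lit …BarlowCovering):
* `exists_laySlabH_of_mem_closure_closure` — two different slabs of ONE presentation meet only on a boundary plane of the first (a datum of `laySlabH`);
* `mem_bilayer_iff_height`, `exists_mem_bilayer_dist_lt_one` (a point of the closed slab `a` is within `1` of a site of bilayer `a`);
* `exists_height_dictionary`, `laySlab_eq_of_dictionary` — parallel presentations with a common site: `height' = ε·height + d·hB`, so every slab of
  the second IS a slab of the first, with the same boundary planes;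
* **`TentPiece.frame_agreement`** — the lemma: equal lattices, or (shared axis `Tf.L e₃` and the contact point lies on a boundary plane of slab `a`).
-/

noncomputable section

open scoped BigOperators InnerProductSpace
open Set

namespace Summit.Ventures.Crystal3D.Cruxes.TextureLiminf.TexShadow

open Summit.Ventures.Crystal3D Summit.Ventures.Crystal3D.Theorems
open Summit.Ventures.Crystal3D.TentCertificate (height hB hB_sq hB_pos height_move mem_laySlab_iff bilayer_eq_image
  bilayer_subset_stacking height_of_mem_bilayer exists_height_eq_of_mem_stacking image_fccRef_eq_of_bilayer_patch_subset)
open Literature.MathematicalPhysics.StatisticalMechanics (IsHaggSeq exists_mem_barlowBilayer_dist_sq_le)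

/-! ### Layer slabs: the boundary data -/

/-- The normals of the two slab constraints are `± L e₃`. -/
theorem fst_of_mem_laySlabH {L : E3 ≃ₗᵢ[ℝ] E3} {s : E3} {i : ℤ} {p₀ : E3 × ℝ} (h : p₀ ∈ laySlabH L s i) :
    p₀.1 = L e₃ ∨ p₀.1 = -(L e₃) := by
  simp only [laySlabH, Finset.mem_insert, Finset.mem_singleton] at h
  rcases h with rfl | rfl
  · exact Or.inl rfl
  · exact Or.inr rfl

/-- **Two different slabs of one presentation meet only on a boundary plane of the first**: a common point of their closures lies on the
plane of one of the two constraints of `laySlabH L s a`. -/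
theorem exists_laySlabH_of_mem_closure_closure (L : E3 ≃ₗᵢ[ℝ] E3) (s : E3) {a a' : ℤ} (haa : a ≠ a') {y : E3}
    (hy : y ∈ closure (laySlab L s a)) (hy' : y ∈ closure (laySlab L s a')) :
    ∃ p₀ ∈ laySlabH L s a, ⟪p₀.1, y⟫_ℝ = p₀.2 := by
  have h1 := closure_laySlab_subset L s a hy
  have h2 := closure_laySlab_subset L s a' hy'
  simp only [mem_setOf_eq] at h1 h2
  have hh := hB_pos
  have hin := height_eq_inner L s y
  rcases lt_or_gt_of_ne haa with hlt | hgt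
  · have hle : (a : ℝ) + 1 ≤ a' := by exact_mod_cast hlt
    have htop : height L s y = ((a : ℝ) + 1) * hB := by
      refine le_antisymm h1.2 ?_
      calc ((a : ℝ) + 1) * hB ≤ (a' : ℝ) * hB := mul_le_mul_of_nonneg_right hle hh.le
        _ ≤ height L s y := h2.1
    refine ⟨(L e₃, ((a : ℝ) + 1) * hB + ⟪L e₃, s⟫_ℝ), by simp [laySlabH], ?_⟩
    simp only
    linarith
  · have hle : (a' : ℝ) + 1 ≤ a := by exact_mod_cast hgt
    have hbot : height L s y = (a : ℝ) * hB := by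
      refine le_antisymm ?_ h1.1
      calc height L s y ≤ ((a' : ℝ) + 1) * hB := h2.2
        _ ≤ (a : ℝ) * hB := mul_le_mul_of_nonneg_right hle hh.le
    refine ⟨(-(L e₃), -((a : ℝ) * hB + ⟪L e₃, s⟫_ℝ)), by simp [laySlabH], ?_⟩
    simp only [inner_neg_left]
    linarith

/-! ### Bilayers by height; the covering radius of a bilayer -/

/-- Membership in a bilayer, by height. -/
theorem mem_bilayer_iff_height (L : E3 ≃ₗᵢ[ℝ] E3) (s : E3) (σ : ℤ → ℤ) (i : ℤ) (w : E3) :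
    w ∈ bilayer L s σ i ↔ w ∈ stacking L s σ ∧ (height L s w = i * hB ∨ height L s w = (i + 1) * hB) := by
  constructor
  · intro hw
    exact ⟨bilayer_subset_stacking L s σ i hw, height_of_mem_bilayer hw⟩
  · rintro ⟨⟨r, hr, rfl⟩, hh⟩
    rw [height_move] at hh
    exact ⟨r, ⟨hr, hh⟩, rfl⟩

/-- **Covering**: a point of the closed slab `a` is within distance `1` of a site of bilayer `a` (lit: `a²/3 + h²/4 = 1/2 < 1`). -/
theorem exists_mem_bilayer_dist_lt_one (L : E3 ≃ₗᵢ[ℝ] E3) (s : E3) (σ : ℤ → ℤ) {a : ℤ} {y : E3} (hy : y ∈ closure (laySlab L s a)) :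
    ∃ x₀ ∈ bilayer L s σ a, dist x₀ y < 1 := by
  have hh := closure_laySlab_subset L s a hy
  simp only [mem_setOf_eq] at hh
  obtain ⟨z, hz, hd⟩ := exists_mem_barlowBilayer_dist_sq_le (a := (1 : ℝ)) one_ne_zero hB_pos σ a (L.symm (y - s)) hh.1 hh.2
  refine ⟨L z + s, ?_, ?_⟩
  · rw [bilayer_eq_image]; exact ⟨z, hz, rfl⟩
  · have hp : dist (L z + s) y = dist (L.symm (y - s)) z := by
      conv_lhs => rw [show y = L (L.symm (y - s)) + s by simp]
      rw [dist_move, dist_comm]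
    rw [hp]
    have h2 : dist (L.symm (y - s)) z ^ 2 < 1 := by
      calc dist (L.symm (y - s)) z ^ 2 ≤ 1 ^ 2 / 3 + hB ^ 2 / 4 := hd
        _ < 1 := by rw [hB_sq]; norm_num
    nlinarith [dist_nonneg (x := L.symm (y - s)) (y := z)]

/-! ### Parallel presentations with a common site: the slab dictionary -/

/-- **Height dictionary**: two presentations with parallel axes and a common site have `height' = ε·height + d·hB` (`ε = ±1`, `d ∈ ℤ`). -/
theorem exists_height_dictionary {L L' : E3 ≃ₗᵢ[ℝ] E3} {s s' : E3} {σ σ' : ℤ → ℤ} (hpar : L e₃ = L' e₃ ∨ L e₃ = -(L' e₃))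
    {x₀ : E3} (hx : x₀ ∈ stacking L s σ) (hx' : x₀ ∈ stacking L' s' σ') :
    ∃ (ε d : ℤ), (ε = 1 ∨ ε = -1) ∧ ∀ w, height L' s' w = ε * height L s w + d * hB := by
  obtain ⟨k, hk⟩ := exists_height_eq_of_mem_stacking hx
  obtain ⟨m, hm⟩ := exists_height_eq_of_mem_stacking hx'
  have e1 := height_eq_inner L s x₀
  have e2 := height_eq_inner L' s' x₀
  rcases hpar with h | h
  · refine ⟨1, m - k, Or.inl rfl, fun w => ?_⟩
    have e3 := height_eq_inner L s w
    have e4 := height_eq_inner L' s' w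
    rw [← h] at e2 e4
    push_cast
    linarith
  · refine ⟨-1, m + k, Or.inr rfl, fun w => ?_⟩
    have e3 := height_eq_inner L s w
    have e4 := height_eq_inner L' s' w
    have h' : L' e₃ = -(L e₃) := by rw [h, neg_neg]
    rw [h'] at e2 e4
    simp only [inner_neg_left] at e2 e4
    push_cast
    linarith

/-- **The slab dictionary**: under the height dictionary every slab `b` of the second presentation IS a slab `a'` of the first, with the same two
boundary planes. -/
theorem laySlab_eq_of_dictionary {L L' : E3 ≃ₗᵢ[ℝ] E3} {s s' : E3} {ε d : ℤ} (hε : ε = 1 ∨ ε = -1)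
    (hdict : ∀ w, height L' s' w = ε * height L s w + d * hB) (b : ℤ) :
    ∃ a' : ℤ, laySlab L' s' b = laySlab L s a' ∧
      ∀ w, (height L' s' w = b * hB ∨ height L' s' w = (b + 1) * hB) ↔ (height L s w = a' * hB ∨ height L s w = (a' + 1) * hB) := by
  have hh := hB_pos
  rcases hε with rfl | rfl
  · refine ⟨b - d, ?_, fun w => ?_⟩
    · ext w
      rw [mem_laySlab_iff, mem_laySlab_iff, hdict w]
      push_cast
      constructor
      · rintro ⟨h1, h2⟩; constructor <;> linarith
      · rintro ⟨h1, h2⟩; constructor <;> linarith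
    · rw [hdict w]
      push_cast
      constructor
      · rintro (h | h)
        · left; linarith
        · right; linarith
      · rintro (h | h)
        · left; linarith
        · right; linarith
  · refine ⟨d - b - 1, ?_, fun w => ?_⟩
    · ext w
      rw [mem_laySlab_iff, mem_laySlab_iff, hdict w]
      push_cast
      constructor
      · rintro ⟨h1, h2⟩; constructor <;> linarith
      · rintro ⟨h1, h2⟩; constructor <;> linarith
    · rw [hdict w]
      push_cast
      constructor
      · rintro (h | h)
        · right; linarith
        · left; linarith
      · rintro (h | h)
        · right; linarith
        · left; linarith

/-! ### The agreement lemma -/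

namespace TentPiece

/-- **FRAME AGREEMENT.**  Two tent pieces whose stackings coincide on a ball containing `closedBall y 2`, a point `y` of the closed slab `a` of the
first and of the closed slab `b` of the second, and a frame witness (parallel axes, or ONE affine fcc lattice containing the common sites): then the
canonical frames of the two bilayers have the SAME lattice, or they share the axis `Tf.L e₃` AND `y` lies on a boundary plane of slab `a`. -/
theorem frame_agreement (Tf Tg : TentPiece) {a b : ℤ} {y z : E3} {ρ : ℝ}
    (hya : y ∈ closure (laySlab Tf.L Tf.s a)) (hyb : y ∈ closure (laySlab Tg.L Tg.s b))
    (hB : Metric.closedBall y 2 ⊆ Metric.ball z ρ)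
    (hS : stacking Tf.L Tf.s Tf.σ ∩ Metric.ball z ρ = stacking Tg.L Tg.s Tg.σ ∩ Metric.ball z ρ)
    (hFr : (Tf.L e₃ = Tg.L e₃ ∨ Tf.L e₃ = -(Tg.L e₃)) ∨
      ∃ (A : E3 ≃ₗᵢ[ℝ] E3) (u : E3), stacking Tf.L Tf.s Tf.σ ∩ Metric.ball z ρ ⊆ (fun q => A q + u) '' fccRef) :
    (Tf.frame a) '' fccRef = (Tg.frame b) '' fccRef ∨
      (SharedAxis (Tf.L e₃) (Tf.frame a) (Tg.frame b) ∧ ∃ p₀ ∈ laySlabH Tf.L Tf.s a, ⟪p₀.1, y⟫_ℝ = p₀.2) := by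
  -- sites of the two bilayers within `1` of `y`; their radius-`1` patches lie inside the ball
  obtain ⟨x₀, hx₀, hd₀⟩ := exists_mem_bilayer_dist_lt_one Tf.L Tf.s Tf.σ hya
  obtain ⟨x₁, hx₁, hd₁⟩ := exists_mem_bilayer_dist_lt_one Tg.L Tg.s Tg.σ hyb
  have hpatch : ∀ {x : E3}, dist x y < 1 → Metric.closedBall x 1 ⊆ Metric.ball z ρ := by
    intro x hx w hw
    refine hB (Metric.mem_closedBall.2 ?_)
    calc dist w y ≤ dist w x + dist x y := dist_triangle _ _ _
      _ ≤ 1 + 1 := add_le_add (Metric.mem_closedBall.1 hw) hx.le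
      _ = 2 := by norm_num
  obtain ⟨uf, huf⟩ := Tf.frame_spec a
  obtain ⟨ug, hug⟩ := Tg.frame_spec b
  rcases hFr with hpar | ⟨A, u, hA⟩
  · -- PARALLEL AXES: the slab dictionary
    have hx₀f : x₀ ∈ stacking Tf.L Tf.s Tf.σ := bilayer_subset_stacking _ _ _ _ hx₀
    have hx₀g : x₀ ∈ stacking Tg.L Tg.s Tg.σ := by
      have : x₀ ∈ stacking Tf.L Tf.s Tf.σ ∩ Metric.ball z ρ := ⟨hx₀f, hpatch hd₀ (Metric.mem_closedBall_self zero_le_one)⟩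
      rw [hS] at this
      exact this.1
    obtain ⟨ε, d, hε, hdict⟩ := exists_height_dictionary hpar hx₀f hx₀g
    obtain ⟨a', hslab, hbdry⟩ := laySlab_eq_of_dictionary hε hdict b
    -- the lattice of `Tg.frame b` is that of `Tf.frame a'`
    have hlat : (Tg.frame b) '' fccRef = (Tf.frame a') '' fccRef := by
      obtain ⟨uf', huf'⟩ := Tf.frame_spec a'
      refine image_fccRef_eq_of_bilayer_patch_subset Tg.hσ Tg.L Tg.s b hx₁ (fun w hw => hug hw.1) (fun w hw => huf' ?_)
      have hwg : w ∈ stacking Tg.L Tg.s Tg.σ ∩ Metric.ball z ρ := ⟨bilayer_subset_stacking _ _ _ _ hw.1, hpatch hd₁ hw.2⟩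
      rw [← hS] at hwg
      have hw1 := hw.1
      rw [mem_bilayer_iff_height] at hw1 ⊢
      exact ⟨hwg.1, (hbdry w).1 hw1.2⟩
    have hax : SharedAxis (Tf.L e₃) (Tf.frame a) (Tg.frame b) := by
      rw [sharedAxis_congr rfl hlat]
      exact Tf.sharedAxis_frame a a'
    by_cases haa : a = a'
    · left
      rw [hlat, haa]
    · right
      refine ⟨hax, exists_laySlabH_of_mem_closure_closure Tf.L Tf.s haa hya ?_⟩
      rw [← hslab]
      exact hyb
  · -- ONE FCC LATTICE on the ball
    left
    have hf : (Tf.frame a) '' fccRef = A '' fccRef :=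
      image_fccRef_eq_of_bilayer_patch_subset Tf.hσ Tf.L Tf.s a hx₀ (fun w hw => huf hw.1)
        (fun w hw => hA ⟨bilayer_subset_stacking _ _ _ _ hw.1, hpatch hd₀ hw.2⟩)
    have hg : (Tg.frame b) '' fccRef = A '' fccRef :=
      image_fccRef_eq_of_bilayer_patch_subset Tg.hσ Tg.L Tg.s b hx₁ (fun w hw => hug hw.1)
        (fun w hw => hA (by rw [hS]; exact ⟨bilayer_subset_stacking _ _ _ _ hw.1, hpatch hd₁ hw.2⟩))
    rw [hf, hg]

end TentPiece

end Summit.Ventures.Crystal3D.Cruxes.TextureLiminf.TexShadow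

end
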